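import Literature.Probability.RandomPlanarGeometry.SAWPulledBridgeFreeEnergy
import Literature.Probability.RandomPlanarGeometry.SAWBridgeRenewalEquation
import Literature.Probability.Process.RenewalSequenceRecurrence
import Literature.Probability.Percolation.DualContours
import HarnessLib

/-!
# The pulled renewal identity: `Z^B_N(y) = Σ_{s=1}^{N} Λ_s(y) Z^B_{N-s}(y)` (Madras–Slade (4.2.2), span-weighted)

Topic `Literature/Probability/RandomPlanarGeometry` (continues `SAWBridgeRenewalEquation.lean` — the
first-break-point bijection `SAB_N ≃ ⨆_{s=1}^{N} iSAB_s × SAB_{N-s}` behind (4.2.2) — and the pulled-walk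
files `SAWPulledFreeEnergyZ2.lean` (`Zd.pulledBridgeZ`), `SAWPulledBridgeGain.lean`
(`Zd.pow_span_concatWalk`: spans add under gluing), `SAWPulledBridgeFreeEnergy.lean`
(`Zd.pulledBridgeFreeEnergy = λ_B(y)`)).

Sources (printed status). N. Madras, G. Slade, *The Self-Avoiding Walk* (1993), §4.2: the renewal
equation (4.2.2) `b_N = Σ_{s=1}^{N} λ_s b_{N-s}` (p. 90, 2013 reprint) and its two-variable (mass /
span-graded) form (4.2.15) `B_z(L) = Σ A_z · B_z` convolution in the span (p. 93); N. R. Beaton,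
*J. Phys. A* 48 (2015) 16FT03, §3, Lemma 1, eq. (7): `B(z,y) = I(z,y)/(1 - I(z,y))` with
`I(z,y) = Σ_{irreducible bridges} z^{|ω|} y^{span ω}` — the generating-function form of the identity below
[cite: Beaton2015, §3, Lemma 1, eq. (7)]. The lane («pcv-sawmu», route R35 «PULL-GAP», a-idea-1 g8
`Sketch_G8_PullGap.lean`) uses the identity at FIXED `y` as a renewal equation in the LENGTH `N`, with the
normalised pair `a_n(y) = Z^B_n(y) e^{-nλ_B(y)}`, `p_i(y) = Λ_i(y) e^{-iλ_B(y)}`.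

## Contents (namespace `Literature.Probability.RandomPlanarGeometry.SAW.Zd`)

Objects (bodies = the planner's typed bodies, `Sketch_G8_PullGap.lean`, a-idea-1 g8):
* `pulledIrrZ d i y = Λ_i(y) := Σ_{ω ∈ iSAB_i} y^{span ω}` and its span-`≥ 2` part `pulledIrrZ₂`;
* `pulledBlockLaw d y i = p_i(y) := Λ_i(y) e^{-iλ_B(y)}` (Sketch: `blockLaw`), `pulledAmp d y n = a_n(y) :=
  Z^B_n(y) e^{-nλ_B(y)}` (Sketch: `amp`), `pulledMeanBlock d y = m(y) := Σ_i i p_i(y)` (Sketch: `meanBlock`).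

Theorems (every `ℤ^{d+1}`, `d + 1 ≥ 1`, unless marked `ℤ²`):
* `pulledBridgeZ_eq_sum_pulledIrrZ_mul` (R35.2) — `Z^B_N(y) = Σ_{s=1}^{N} Λ_s(y) Z^B_{N-s}(y)`, `N ≥ 1`;
* `pulled_renewal_identity` (R35.2x) — `Σ_{k ≤ N} Z^B_k(y) x^k (1 - Σ_{i=1}^{N-k} Λ_i(y) x^i) = 1`, formal
  in `x` and `y`;
* `bridges_one`, `pulledIrrZ_one` (R35.s1, part 1, every `d`) — the only one-step bridge is `+e₁`, so
  `Λ_1(y) = y`; `pulledBlockLaw_one_pos` (R35.0) — `p_1(y) > 0` for `y > 0`;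
* `pulledAmp_renewal` — `a_n = Σ_{k ≤ n} p_k a_{n-k}` (`n ≥ 1`), `pulledAmp_le_one` (`Z^B_n ≤ e^{nλ_B}`,
  Fekete), and `sum_range_pulledBlockLaw_le_one` (R35.s2, gap-free sub-Kesten inequality) —
  `Σ_{i<K} p_i(y) ≤ 1` for every `K` and every `y > 0` (Feller XIII.3 Thm 2, tree
  `Renewal.sum_range_f_le_one`).

## What is new here (not in print)

Nothing conceptually: the identity is Beaton's (7) / M–S (4.2.2) with span weights, kernel-checked on the
tree's site model of bridges; the sub-Kesten inequality `Σ p_i(y) ≤ 1` at every `y > 0` is the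
renewal-theory half of Beaton's Lemma 2 (`I(e^{-λ(y)}, y) = 1`, which needs the mass gap — route R35.4).
-/

noncomputable section

open Finset Filter Topology Literature.Probability.LatticeModels Literature.Probability.Percolation
open scoped BigOperators

namespace Literature.Probability.RandomPlanarGeometry.SAW.Zd

variable {d : ℕ}

/-! ### Objects -/

/-- `Λ_i(y) := Σ_{ω ∈ iSAB_i} y^{span ω}`, the span-weighted count of the `i`-step irreducible bridges
(Beaton's `I(z,y)` is `Σ_i Λ_i(y) z^i`). Body = the planner's typed body (a-idea-1 g8).
[cite: Beaton2015, §3, Lemma 1, eq. (7)] -/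
def pulledIrrZ (d : ℕ) [NeZero d] (i : ℕ) (y : ℝ) : ℝ :=
  ∑ ω ∈ irreducibleBridges d i, y ^ (ω i 0).toNat

open Classical in
/-- The span-`≥ 2` part of `Λ_i(y)`. Body = the planner's typed body (a-idea-1 g8).
[cite: Beaton2015, §3, Lemma 1, eq. (7); MadrasSlade1993, §4.2, eq. (4.2.20)–(4.2.21) (p. 94, 2013 reprint)] -/
def pulledIrrZ₂ (d : ℕ) [NeZero d] (i : ℕ) (y : ℝ) : ℝ :=
  ∑ ω ∈ (irreducibleBridges d i).filter (fun ω => (2 : ℤ) ≤ ω i 0), y ^ (ω i 0).toNat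

/-- The block-length law `p_i(y) := Λ_i(y) e^{-i λ_B(y)}` (Sketch name `blockLaw`).
[cite: Beaton2015, §3, Lemma 2] -/
def pulledBlockLaw (d : ℕ) [NeZero d] (y : ℝ) (i : ℕ) : ℝ :=
  pulledIrrZ d i y * Real.exp (-(i : ℝ) * pulledBridgeFreeEnergy d y)

/-- The normalised amplitude `a_n(y) := Z^B_n(y) e^{-n λ_B(y)}` (Sketch name `amp`).
[cite: Beaton2015, §3; MadrasSlade1993, §4.2, eq. (4.2.16) (p. 93, 2013 reprint)] -/
def pulledAmp (d : ℕ) [NeZero d] (y : ℝ) (n : ℕ) : ℝ :=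
  pulledBridgeZ d n y * Real.exp (-(n : ℝ) * pulledBridgeFreeEnergy d y)

/-- The mean block length `m(y) := Σ_i i · p_i(y)` (Sketch name `meanBlock`).
[cite: MadrasSlade1993, §4.2, Theorem 4.2.5 (p. 95, 2013 reprint); Appendix B, eq. (B.5)] -/
def pulledMeanBlock (d : ℕ) [NeZero d] (y : ℝ) : ℝ := ∑' i : ℕ, (i : ℝ) * pulledBlockLaw d y i

/-! ### Elementary properties -/

section Basic

variable [NeZero d]

/-- `Λ_0 = 0`: there is no `0`-step irreducible bridge. [cite: DuminilCopinHammond2013, §2.2] -/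
theorem pulledIrrZ_zero (y : ℝ) : pulledIrrZ d 0 y = 0 := by
  unfold pulledIrrZ
  refine Finset.sum_eq_zero fun ω hω => ?_
  have := (mem_irreducibleBridges.1 hω).2.1
  omega

/-- `Λ_i(y) ≥ 0` for `y ≥ 0`. [cite: Beaton2015, §3, Lemma 1] -/
theorem pulledIrrZ_nonneg (i : ℕ) {y : ℝ} (hy : 0 ≤ y) : 0 ≤ pulledIrrZ d i y :=
  Finset.sum_nonneg fun _ _ => pow_nonneg hy _

/-- The span-`≥ 2` part is nonnegative for `y ≥ 0`. [cite: Beaton2015, §3, Lemma 1] -/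
theorem pulledIrrZ₂_nonneg (i : ℕ) {y : ℝ} (hy : 0 ≤ y) : 0 ≤ pulledIrrZ₂ d i y :=
  Finset.sum_nonneg fun _ _ => pow_nonneg hy _

/-- The span-`≥ 2` part is at most the whole, for `y ≥ 0`. [cite: Beaton2015, §3, Lemma 1] -/
theorem pulledIrrZ₂_le_pulledIrrZ (i : ℕ) {y : ℝ} (hy : 0 ≤ y) : pulledIrrZ₂ d i y ≤ pulledIrrZ d i y := by
  classical
  unfold pulledIrrZ pulledIrrZ₂
  exact Finset.sum_le_sum_of_subset_of_nonneg (Finset.filter_subset _ _) fun _ _ _ => pow_nonneg hy _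

/-- `Λ_i(y) ≤ Z^B_i(y)` for `y ≥ 0` (irreducible bridges are bridges). [cite: Beaton2015, §3, Lemma 1] -/
theorem pulledIrrZ_le_pulledBridgeZ (i : ℕ) {y : ℝ} (hy : 0 ≤ y) : pulledIrrZ d i y ≤ pulledBridgeZ d i y := by
  rw [pulledIrrZ, pulledBridgeZ_eq_sum_bridges]
  exact Finset.sum_le_sum_of_subset_of_nonneg (irreducibleBridges_subset_bridges i)
    fun _ _ _ => pow_nonneg hy _

/-- `p_i(y) ≥ 0` for `y ≥ 0`. [cite: Beaton2015, §3, Lemma 2] -/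
theorem pulledBlockLaw_nonneg {y : ℝ} (hy : 0 ≤ y) (i : ℕ) : 0 ≤ pulledBlockLaw d y i :=
  mul_nonneg (pulledIrrZ_nonneg i hy) (Real.exp_pos _).le

/-- `p_0 = 0`. [cite: Beaton2015, §3, Lemma 2] -/
theorem pulledBlockLaw_zero (y : ℝ) : pulledBlockLaw d y 0 = 0 := by
  rw [pulledBlockLaw, pulledIrrZ_zero, zero_mul]

end Basic

/-- `a_0 = 1`. [cite: MadrasSlade1993, §4.2, eq. (4.2.16) (p. 93, 2013 reprint)] -/
theorem pulledAmp_zero (d : ℕ) (y : ℝ) : pulledAmp (d + 1) y 0 = 1 := by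
  simp [pulledAmp, pulledBridgeZ_zero]

/-- `a_n(y) ≥ 0` (`y > 0`). [cite: MadrasSlade1993, §4.2, eq. (4.2.16) (p. 93, 2013 reprint)] -/
theorem pulledAmp_nonneg (d : ℕ) {y : ℝ} (hy : 0 < y) (n : ℕ) : 0 ≤ pulledAmp (d + 1) y n :=
  mul_nonneg (pulledBridgeZ_pos d n hy).le (Real.exp_pos _).le

/-- **`a_n(y) ≤ 1`**, i.e. `Z^B_n(y) ≤ e^{n λ_B(y)}` for every `n` (Fekete: `λ_B` is the supremum of
`N⁻¹ log Z^B_N`, tree `log_div_le_pulledBridgeFreeEnergy`). [cite: MadrasSlade1993, Lemma 1.2.2 (Fekete) and §4.2, eq. (4.2.16) (p. 93, 2013 reprint)] -/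
theorem pulledAmp_le_one (d : ℕ) {y : ℝ} (hy : 0 < y) (n : ℕ) : pulledAmp (d + 1) y n ≤ 1 := by
  unfold pulledAmp
  rcases Nat.eq_zero_or_pos n with rfl | hn
  · simp [pulledBridgeZ_zero]
  · have hZ : 0 < pulledBridgeZ (d + 1) n y := pulledBridgeZ_pos d n hy
    have h := log_div_le_pulledBridgeFreeEnergy d hy (N := n) hn
    have hn' : (0 : ℝ) < n := by exact_mod_cast hn
    rw [div_le_iff₀ hn'] at h
    have h2 : pulledBridgeZ (d + 1) n y ≤ Real.exp ((n : ℝ) * pulledBridgeFreeEnergy (d + 1) y) := by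
      rw [← Real.log_le_iff_le_exp hZ]; linarith
    calc pulledBridgeZ (d + 1) n y * Real.exp (-(n : ℝ) * pulledBridgeFreeEnergy (d + 1) y)
        ≤ Real.exp ((n : ℝ) * pulledBridgeFreeEnergy (d + 1) y)
          * Real.exp (-(n : ℝ) * pulledBridgeFreeEnergy (d + 1) y) :=
          mul_le_mul_of_nonneg_right h2 (Real.exp_pos _).le
      _ = 1 := by rw [← Real.exp_add]; simp

/-! ### R35.2 — the pulled renewal equation -/

/-- **The pulled renewal equation** (route R35.2; Beaton's (7) coefficientwise, M–S (4.2.2) with span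
weights): for `N ≥ 1`, `Z^B_N(y) = Σ_{s=1}^{N} Λ_s(y) · Z^B_{N-s}(y)` — every `N`-step bridge is, in
exactly one way, an irreducible `s`-step bridge (`s` = its first break point) glued to an `(N-s)`-step
bridge, and spans add under gluing. [cite: Beaton2015, §3, Lemma 1, eq. (7); MadrasSlade1993, §4.2, eq. (4.2.2) (p. 90, 2013 reprint)] -/
theorem pulledBridgeZ_eq_sum_pulledIrrZ_mul (d N : ℕ) (y : ℝ) (hN : 1 ≤ N) :
    pulledBridgeZ (d + 1) N y =
      ∑ s ∈ Icc 1 N, pulledIrrZ (d + 1) s y * pulledBridgeZ (d + 1) (N - s) y := by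
  classical
  -- both sides as sums over finite sets of walks
  have hR : ∑ s ∈ Icc 1 N, pulledIrrZ (d + 1) s y * pulledBridgeZ (d + 1) (N - s) y =
      ∑ p ∈ (Icc 1 N).sigma (fun s => irreducibleBridges (d + 1) s ×ˢ bridges (d + 1) (N - s)),
        y ^ (p.2.1 p.1 0).toNat * y ^ (p.2.2 (N - p.1) 0).toNat := by
    rw [Finset.sum_sigma]
    refine Finset.sum_congr rfl fun s _ => ?_
    rw [pulledIrrZ, pulledBridgeZ_eq_sum_bridges, Finset.sum_mul_sum, Finset.sum_product]
  rw [hR, pulledBridgeZ_eq_sum_bridges]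
  symm
  refine Finset.sum_nbij (fun p => concatWalk p.1 p.2.1 p.2.2) ?_ ?_ ?_ ?_
  · -- the gluing lands in the `N`-step bridges
    rintro ⟨s, η, τ⟩ hp
    simp only [Finset.mem_sigma, Finset.mem_Icc, Finset.mem_product] at hp
    obtain ⟨⟨-, hsN⟩, hη, hτ⟩ := hp
    exact concatWalk_mem_bridges hsN (irreducibleBridges_subset_bridges s hη) hτ
  · -- injectivity: the gluing time is the first renewal time, then the pieces are determined
    rintro ⟨s, η, τ⟩ hp ⟨s', η', τ'⟩ hp' h
    simp only [Finset.coe_sigma, Finset.coe_product, Set.mem_sigma_iff, Finset.mem_coe, Finset.mem_Icc,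
      Set.mem_prod] at hp hp'
    obtain ⟨⟨hs1, hsN⟩, hη, hτ⟩ := hp
    obtain ⟨⟨hs1', hsN'⟩, hη', hτ'⟩ := hp'
    dsimp only at h
    have hren := isRenewalTime_concatWalk hsN (irreducibleBridges_subset_bridges s hη) hτ
    have hren' := isRenewalTime_concatWalk hsN' (irreducibleBridges_subset_bridges s' hη') hτ'
    obtain rfl : s = s' := by
      by_contra hne
      rcases lt_or_gt_of_ne hne with hlt | hlt
      · rw [h] at hren
        exact not_isRenewalTime_concatWalk_of_lt hsN' hη' hs1 hlt hren
      · rw [← h] at hren'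
        exact not_isRenewalTime_concatWalk_of_lt hsN hη hs1' hlt hren'
    obtain ⟨h1, h2⟩ := concatWalk_injective_pieces
      (mem_bridges.1 (irreducibleBridges_subset_bridges s hη)).1 (mem_bridges.1 hτ).1
      (mem_bridges.1 (irreducibleBridges_subset_bridges s hη')).1 (mem_bridges.1 hτ').1 h
    subst h1 h2
    rfl
  · -- surjectivity: split a bridge at its first renewal time
    intro ω hω
    rw [Finset.mem_coe] at hω
    obtain ⟨s, hs1, hs, hmin⟩ := exists_first_renewalTime hN (mem_bridges.1 hω).2
    refine ⟨⟨s, fun i => ω (min i s), fun j => ω (s + j) - ω s⟩, ?_, concatWalk_head_tail ω⟩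
    simp only [Finset.coe_sigma, Finset.coe_product, Set.mem_sigma_iff, Finset.mem_coe, Finset.mem_Icc,
      Set.mem_prod]
    exact ⟨⟨hs1, hs.1⟩, headWalk_mem_irreducibleBridges hω hs1 hs hmin, tailShift_mem_bridges hω hs⟩
  · -- the weights: spans add
    rintro ⟨s, η, τ⟩ hp
    simp only [Finset.mem_sigma, Finset.mem_Icc, Finset.mem_product] at hp
    obtain ⟨⟨-, hsN⟩, hη, hτ⟩ := hp
    dsimp only
    have h := pow_span_concatWalk y (irreducibleBridges_subset_bridges s hη) hτ
    rw [Nat.add_sub_cancel' hsN] at h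
    exact h.symm

/-- The renewal equation reflected: `Σ_{n ≤ N} Λ_{N+1-n}(y) Z^B_n(y) = Z^B_{N+1}(y)`.
[cite: Beaton2015, §3, Lemma 1, eq. (7); MadrasSlade1993, §4.2, eq. (4.2.2) (p. 90, 2013 reprint)] -/
theorem sum_reflect_pulled_renewal (d N : ℕ) (y : ℝ) :
    ∑ n ∈ range (N + 1), pulledIrrZ (d + 1) (N + 1 - n) y * pulledBridgeZ (d + 1) n y =
      pulledBridgeZ (d + 1) (N + 1) y := by
  rw [pulledBridgeZ_eq_sum_pulledIrrZ_mul d (N + 1) y (by omega)]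
  -- reflect `n ↦ N + 1 - n`: `range (N+1)` ↔ `Icc 1 (N+1)`
  refine Finset.sum_nbij' (fun n => N + 1 - n) (fun s => N + 1 - s) (fun n hn => ?_) (fun s hs => ?_)
    (fun n hn => ?_) (fun s hs => ?_) (fun n hn => ?_)
  · rw [Finset.mem_range] at hn; rw [Finset.mem_Icc]; omega
  · rw [Finset.mem_Icc] at hs; rw [Finset.mem_range]; omega
  · rw [Finset.mem_range] at hn; omega
  · rw [Finset.mem_Icc] at hs; omega
  · rw [Finset.mem_range] at hn
    rw [show N + 1 - (N + 1 - n) = n by omega]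

/-! ### R35.2x — the identity formal in `x` -/

/-- **The pulled renewal identity, formal in `x` and `y`** (route R35.2x; the span-weighted twin of the
tree's `bridge_renewal_identity`): for every real `x`, `y` and every `N`,
`Σ_{k ≤ N} Z^B_k(y) x^k · (1 - Σ_{i=1}^{N-k} Λ_i(y) x^i) = 1`. (The coefficient of `x^n`, `1 ≤ n ≤ N`,
vanishes by the renewal equation; Beaton's `B = I/(1-I)` truncated.)
[cite: Beaton2015, §3, Lemma 1, eq. (7); MadrasSlade1993, §4.2, eq. (4.2.3) (p. 90, 2013 reprint) and Appendix B, eq. (B.5)] -/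
theorem pulled_renewal_identity (d N : ℕ) (x y : ℝ) :
    ∑ k ∈ range (N + 1), pulledBridgeZ (d + 1) k y * x ^ k *
      (1 - ∑ i ∈ Icc 1 (N - k), pulledIrrZ (d + 1) i y * x ^ i) = 1 := by
  induction N with
  | zero =>
    simp [pulledBridgeZ_zero]
  | succ N ih =>
    rw [Finset.sum_range_succ, Nat.sub_self]
    have hI0 : ∑ i ∈ Icc 1 0, pulledIrrZ (d + 1) i y * x ^ i = 0 := by simp
    rw [hI0, sub_zero, mul_one]
    -- split off the top term `Λ_{N+1-k} x^{N+1-k}` of each inner sum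
    have hstep : ∀ k ∈ range (N + 1),
        pulledBridgeZ (d + 1) k y * x ^ k * (1 - ∑ i ∈ Icc 1 (N + 1 - k), pulledIrrZ (d + 1) i y * x ^ i) =
          pulledBridgeZ (d + 1) k y * x ^ k * (1 - ∑ i ∈ Icc 1 (N - k), pulledIrrZ (d + 1) i y * x ^ i) -
            x ^ (N + 1) * (pulledIrrZ (d + 1) (N + 1 - k) y * pulledBridgeZ (d + 1) k y) := by
      intro k hk
      rw [Finset.mem_range] at hk
      rw [show N + 1 - k = (N - k) + 1 by omega, ← Finset.insert_Icc_right_eq_Icc_add_one (by omega),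
        Finset.sum_insert (by simp)]
      have : x ^ k * x ^ (N - k + 1) = x ^ (N + 1) := by rw [← pow_add]; congr 1; omega
      calc pulledBridgeZ (d + 1) k y * x ^ k *
            (1 - (pulledIrrZ (d + 1) (N - k + 1) y * x ^ (N - k + 1) +
              ∑ i ∈ Icc 1 (N - k), pulledIrrZ (d + 1) i y * x ^ i))
          = pulledBridgeZ (d + 1) k y * x ^ k * (1 - ∑ i ∈ Icc 1 (N - k), pulledIrrZ (d + 1) i y * x ^ i) -
              (x ^ k * x ^ (N - k + 1)) * (pulledIrrZ (d + 1) (N - k + 1) y * pulledBridgeZ (d + 1) k y) := by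
            ring
        _ = _ := by rw [this]
    rw [Finset.sum_congr rfl hstep, Finset.sum_sub_distrib, ih, ← Finset.mul_sum,
      sum_reflect_pulled_renewal]
    ring

/-! ### R35.s1 (part 1, every dimension) and R35.0: the one-step bridge -/

/-- **The only one-step bridge is the step `+e₁`** (every `ℤ^d`, `d ≥ 1`): `SAB_1 = {(0, e₁)}`.
[cite: MadrasSlade1993, Definition 1.2.4 and §4.2, Definition 4.2.1 (p. 90, 2013 reprint)] -/
theorem bridges_one (d : ℕ) [NeZero d] : bridges d 1 = {straightWalk d 1} := by
  refine Finset.eq_singleton_iff_unique_mem.2 ⟨?_, fun ω hω => ?_⟩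
  · refine mem_bridges.2 ⟨straightWalk_mem_saws d 1, fun i h1 h2 => ?_⟩
    obtain rfl : i = 1 := le_antisymm h2 h1
    simp [straightWalk]
  · obtain ⟨hωs, hb⟩ := mem_bridges.1 hω
    obtain ⟨h0, hend, hadj, -⟩ := mem_saws.1 hωs
    have h10 : 0 < ω 1 0 := by have := (hb 1 le_rfl le_rfl).1; rwa [h0] at this
    have hω1 : ω 1 = Pi.single 0 1 := by
      have ha := hadj 0 Nat.zero_lt_one
      rw [zero_add, h0, zdGraph_adj_iff] at ha
      obtain ⟨i, hi | hi⟩ := ha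
      · rw [zero_add] at hi
        have hc := congrFun hi 0
        by_cases hi0 : i = 0
        · subst hi0; exact hi
        · rw [Pi.single_eq_of_ne (Ne.symm hi0)] at hc
          rw [hc] at h10
          exact absurd h10 (lt_irrefl 0)
      · have hc := congrFun hi 0
        simp only [Pi.zero_apply, Pi.add_apply] at hc
        by_cases hi0 : i = 0
        · subst hi0
          rw [Pi.single_eq_same] at hc
          omega
        · rw [Pi.single_eq_of_ne (Ne.symm hi0)] at hc
          omega
    funext j
    rcases Nat.eq_zero_or_pos j with rfl | hj
    · rw [h0]; simp [straightWalk]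
    · rw [hend j hj, hω1]
      simp [straightWalk, min_eq_right (show 1 ≤ j from hj)]

/-- **`Λ_1(y) = y`** in every dimension (route R35.s1, first part): the one-step bridge `+e₁` is
irreducible and has span `1`. [cite: Beaton2015, §3, Lemma 1; MadrasSlade1993, §4.2, Definition 4.2.1 (p. 90, 2013 reprint)] -/
theorem pulledIrrZ_one (d : ℕ) [NeZero d] (y : ℝ) : pulledIrrZ d 1 y = y := by
  rw [pulledIrrZ, irreducibleBridges_one, bridges_one, Finset.sum_singleton]
  simp [straightWalk]

/-- **R35.0 — `p_1(y) = y e^{-λ_B(y)} > 0`** for `y > 0` (aperiodicity of the block-length law).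
[cite: Beaton2015, §3, Lemma 2] -/
theorem pulledBlockLaw_one_pos (d : ℕ) [NeZero d] {y : ℝ} (hy : 0 < y) : 0 < pulledBlockLaw d y 1 := by
  rw [pulledBlockLaw, pulledIrrZ_one]
  exact mul_pos hy (Real.exp_pos _)

/-- `p_1(y) = y e^{-λ_B(y)}`. [cite: Beaton2015, §3, Lemma 2] -/
theorem pulledBlockLaw_one (d : ℕ) [NeZero d] (y : ℝ) :
    pulledBlockLaw d y 1 = y * Real.exp (-pulledBridgeFreeEnergy d y) := by
  rw [pulledBlockLaw, pulledIrrZ_one]; simp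

/-! ### The normalised renewal equation and the sub-Kesten inequality (R35.s2) -/

/-- **The renewal equation in the normalised variables**: `a_n(y) = Σ_{k ≤ n} p_k(y) a_{n-k}(y)` for
`n ≥ 1` (`p_0 = 0`), from R35.2 by distributing `e^{-nλ_B} = e^{-kλ_B} e^{-(n-k)λ_B}`.
[cite: Beaton2015, §3, Lemma 1, eq. (7); MadrasSlade1993, §4.2, eq. (4.2.16) (p. 93, 2013 reprint)] -/
theorem pulledAmp_renewal (d : ℕ) (y : ℝ) (n : ℕ) (hn : 1 ≤ n) :
    pulledAmp (d + 1) y n =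
      ∑ k ∈ range (n + 1), pulledBlockLaw (d + 1) y k * pulledAmp (d + 1) y (n - k) := by
  have h2 := pulledBridgeZ_eq_sum_pulledIrrZ_mul d n y hn
  have hsplit : ∑ k ∈ range (n + 1), pulledBlockLaw (d + 1) y k * pulledAmp (d + 1) y (n - k) =
      ∑ k ∈ Icc 1 n, pulledBlockLaw (d + 1) y k * pulledAmp (d + 1) y (n - k) := by
    have hset : range (n + 1) = insert 0 (Icc 1 n) := by
      ext k
      simp only [Finset.mem_range, Finset.mem_insert, Finset.mem_Icc]
      omega
    rw [hset, Finset.sum_insert (by simp), pulledBlockLaw_zero, zero_mul, zero_add]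
  rw [hsplit, pulledAmp, h2, Finset.sum_mul]
  refine Finset.sum_congr rfl fun k hk => ?_
  have hkn : k ≤ n := (Finset.mem_Icc.1 hk).2
  simp only [pulledBlockLaw, pulledAmp]
  have hcast : ((n - k : ℕ) : ℝ) = (n : ℝ) - k := by push_cast [Nat.cast_sub hkn]; ring
  rw [hcast]
  have : Real.exp (-(n : ℝ) * pulledBridgeFreeEnergy (d + 1) y) =
      Real.exp (-(k : ℝ) * pulledBridgeFreeEnergy (d + 1) y) *
        Real.exp (-((n : ℝ) - k) * pulledBridgeFreeEnergy (d + 1) y) := by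
    rw [← Real.exp_add]; ring_nf
  rw [this]; ring

/-- **R35.s2 — the gap-free sub-Kesten inequality**: `Σ_{i<K} p_i(y) ≤ 1` for every `K` and every
`y > 0`, in every dimension — Feller XIII.3 Theorem 2 (tree `Renewal.sum_range_f_le_one`) for the
renewal pair `(a, p)`: `a_0 = 1`, `0 ≤ a_n ≤ 1`, `p ≥ 0`, `p_0 = 0`, `a_n = Σ p_k a_{n-k}`. Beaton's Lemma 2
(`Σ_i p_i(y) = 1` for `y ≥ 1`) needs the mass gap (route R35.4); this half does not.
[cite: Beaton2015, §3, Lemma 2; MadrasSlade1993, §4.2, eq. (4.2.15) and Appendix B, eq. (B.5)] -/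
theorem sum_range_pulledBlockLaw_le_one (d : ℕ) {y : ℝ} (hy : 0 < y) (K : ℕ) :
    ∑ i ∈ range K, pulledBlockLaw (d + 1) y i ≤ 1 :=
  Literature.Probability.Process.Renewal.sum_range_f_le_one (pulledAmp_zero d y) (pulledAmp_nonneg d hy)
    (pulledAmp_le_one d hy) (pulledBlockLaw_nonneg hy.le) (pulledBlockLaw_zero y)
    (fun n hn => pulledAmp_renewal d y n hn) K

/-- `Σ' i, p_i(y) ≤ 1` and summability, for every `y > 0`. [cite: Beaton2015, §3, Lemma 2] -/
theorem summable_pulledBlockLaw (d : ℕ) {y : ℝ} (hy : 0 < y) : Summable (pulledBlockLaw (d + 1) y) :=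
  summable_of_sum_range_le (pulledBlockLaw_nonneg hy.le) (sum_range_pulledBlockLaw_le_one d hy)

/-- `Σ' i, p_i(y) ≤ 1` for every `y > 0`. [cite: Beaton2015, §3, Lemma 2] -/
theorem tsum_pulledBlockLaw_le_one (d : ℕ) {y : ℝ} (hy : 0 < y) : ∑' i, pulledBlockLaw (d + 1) y i ≤ 1 :=
  Real.tsum_le_of_sum_range_le (pulledBlockLaw_nonneg hy.le) (sum_range_pulledBlockLaw_le_one d hy)


/-! ### R35.s1 (part 2, `ℤ²`): the span-one irreducible bridges are the two L-shaped walks -/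

/-- The L-walk on `ℤ²`: one step `+e₁`, then `i - 1` steps `δ e₂` (`δ = ±1`), frozen after time `i`:
`j ↦ e₁ + δ (min j i - 1) e₂` for `j ≥ 1`. [cite: MadrasSlade1993, §4.2, remark after Theorem 4.2.4 (p. 94, 2013 reprint)] -/
def ellWalk (δ : ℤ) (i : ℕ) : ℕ → Site 2 :=
  fun j => if j = 0 then 0 else Pi.single 0 1 + Pi.single 1 (δ * (((min j i : ℕ) : ℤ) - 1))

/-- `ellWalk δ i 0 = 0`. [cite: MadrasSlade1993, §4.2 (p. 94, 2013 reprint)] -/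
@[simp] theorem ellWalk_zero (δ : ℤ) (i : ℕ) : ellWalk δ i 0 = 0 := by simp [ellWalk]

/-- First coordinate of the L-walk: `1` from time `1` on. [cite: MadrasSlade1993, §4.2 (p. 94, 2013 reprint)] -/
theorem ellWalk_apply_fst (δ : ℤ) (i : ℕ) {j : ℕ} (hj : 1 ≤ j) : ellWalk δ i j 0 = 1 := by
  simp [ellWalk, show j ≠ 0 by omega]

/-- Second coordinate of the L-walk: `δ (min j i - 1)` from time `1` on.
[cite: MadrasSlade1993, §4.2 (p. 94, 2013 reprint)] -/
theorem ellWalk_apply_snd (δ : ℤ) (i : ℕ) {j : ℕ} (hj : 1 ≤ j) :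
    ellWalk δ i j 1 = δ * (((min j i : ℕ) : ℤ) - 1) := by
  simp [ellWalk, show j ≠ 0 by omega]

/-- **The L-walks are irreducible bridges** (`i ≥ 1`, `δ = ±1`): span `1`, first coordinate constant after
the first step, so no break point in `[1, i-1]`. [cite: MadrasSlade1993, §4.2, Definition 4.2.1 and remark after Theorem 4.2.4 (pp. 90, 94, 2013 reprint)] -/
theorem ellWalk_mem_irreducibleBridges {δ : ℤ} (hδ : δ = 1 ∨ δ = -1) {i : ℕ} (hi : 1 ≤ i) :
    ellWalk δ i ∈ irreducibleBridges 2 i := by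
  have hδ0 : δ ≠ 0 := by rcases hδ with rfl | rfl <;> norm_num
  have hsaw : ellWalk δ i ∈ saws 2 i := by
    refine mem_saws.2 ⟨ellWalk_zero δ i, fun j hj => ?_, fun j hj => ?_, fun j hj j' hj' hjj => ?_⟩
    · -- frozen after `i`
      refine Contour.site_ext ?_ ?_
      · rw [ellWalk_apply_fst δ i (hi.trans hj), ellWalk_apply_fst δ i hi]
      · rw [ellWalk_apply_snd δ i (hi.trans hj), ellWalk_apply_snd δ i hi, min_eq_right hj, min_self]
    · -- steps
      rw [zdGraph_adj_iff]
      rcases Nat.eq_zero_or_pos j with rfl | hj1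
      · refine ⟨0, Or.inl (Contour.site_ext ?_ ?_)⟩
        · rw [ellWalk_apply_fst δ i le_rfl]; simp
        · rw [ellWalk_apply_snd δ i le_rfl, min_eq_left hi]; simp
      · have e0 : ellWalk δ i (j + 1) 0 = ellWalk δ i j 0 := by
          rw [ellWalk_apply_fst δ i (by omega), ellWalk_apply_fst δ i hj1]
        have e1 : ellWalk δ i (j + 1) 1 = ellWalk δ i j 1 + δ := by
          rw [ellWalk_apply_snd δ i (by omega), ellWalk_apply_snd δ i hj1, min_eq_left hj.le,
            min_eq_left (by omega : j + 1 ≤ i)]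
          push_cast
          ring
        rcases hδ with rfl | rfl
        · refine ⟨1, Or.inl (Contour.site_ext ?_ ?_)⟩
          · rw [Pi.add_apply, e0]; simp
          · rw [Pi.add_apply, e1]; simp
        · refine ⟨1, Or.inr (Contour.site_ext ?_ ?_)⟩
          · rw [Pi.add_apply, e0]; simp
          · rw [Pi.add_apply, e1]; simp
    · -- injective on `[0, i]`
      simp only [Set.mem_setOf_eq] at hj hj'
      by_contra hne
      rcases Nat.eq_zero_or_pos j with rfl | hj1 <;> rcases Nat.eq_zero_or_pos j' with rfl | hj1'
      · exact hne rfl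
      · have := congrFun hjj 0
        rw [ellWalk_zero, ellWalk_apply_fst δ i hj1'] at this
        exact absurd this (by simp)
      · have := congrFun hjj 0
        rw [ellWalk_zero, ellWalk_apply_fst δ i hj1] at this
        exact absurd this (by simp)
      · have := congrFun hjj 1
        rw [ellWalk_apply_snd δ i hj1, ellWalk_apply_snd δ i hj1', min_eq_left hj, min_eq_left hj'] at this
        have h2 := mul_left_cancel₀ hδ0 this
        omega
  have hbr : IsBridge i (ellWalk δ i) := fun j h1 h2 => by
    rw [ellWalk_zero, ellWalk_apply_fst δ i h1, ellWalk_apply_fst δ i hi]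
    simp
  refine mem_irreducibleBridges.2 ⟨mem_bridges.2 ⟨hsaw, hbr⟩, hi, hbr, fun k hk1 hk2 hren => ?_⟩
  -- a break point `k ∈ [1, i-1]` would need `x₁` to increase strictly at the step `k → k+1`
  have h := (hren.2.2 1 le_rfl (by omega)).1
  simp only [add_zero] at h
  rw [ellWalk_apply_fst δ i hk1, ellWalk_apply_fst δ i (by omega)] at h
  exact lt_irrefl _ h

/-- The span of the L-walk is `1`. [cite: MadrasSlade1993, §4.2 (p. 94, 2013 reprint)] -/
theorem ellWalk_span (δ : ℤ) {i : ℕ} (hi : 1 ≤ i) : ellWalk δ i i 0 = 1 := ellWalk_apply_fst δ i hi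

/-- The two L-walks differ (at time `2`, `i ≥ 2`). [cite: MadrasSlade1993, §4.2 (p. 94, 2013 reprint)] -/
theorem ellWalk_one_ne_neg_one {i : ℕ} (hi : 2 ≤ i) : ellWalk 1 i ≠ ellWalk (-1) i := by
  intro h
  have := congrFun (congrFun h 2) 1
  rw [ellWalk_apply_snd 1 i (by omega), ellWalk_apply_snd (-1) i (by omega), min_eq_left hi] at this
  norm_num at this

/-- **Characterisation: a span-one bridge on `ℤ²` with `i ≥ 2` steps is one of the two L-walks** — after
the forced first step `+e₁` the first coordinate stays `1`, so every later step is `±e₂`, and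
self-avoidance forbids a reversal. [cite: MadrasSlade1993, §4.2, remark after Theorem 4.2.4 (p. 94, 2013 reprint)] -/
theorem eq_ellWalk_of_span_one {i : ℕ} (hi : 2 ≤ i) {ω : ℕ → Site 2} (hω : ω ∈ bridges 2 i)
    (hspan : ω i 0 = 1) : (ω 2 1 = 1 ∨ ω 2 1 = -1) ∧ ω = ellWalk (ω 2 1) i := by
  obtain ⟨hωs, hb⟩ := mem_bridges.1 hω
  obtain ⟨h0, hend, hadj, hinj⟩ := mem_saws.1 hωs
  have h00 : ω 0 0 = 0 := by rw [h0]; rfl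
  have h01 : ω 0 1 = 0 := by rw [h0]; rfl
  -- (a) the first coordinate is `1` on `[1, i]`
  have hc0 : ∀ j, 1 ≤ j → j ≤ i → ω j 0 = 1 := fun j h1 h2 => by
    have h := hb j h1 h2
    rw [h00, hspan] at h
    omega
  -- (b) each step `j → j+1` keeps the first coordinate when `1 ≤ j < i`, so it moves the second by `±1`;
  --     the first step moves the first coordinate, so it keeps the second
  have hstep : ∀ j, j < i → (ω (j + 1) 0 = ω j 0 → (ω (j + 1) 1 = ω j 1 + 1 ∨ ω (j + 1) 1 = ω j 1 - 1)) ∧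
      (ω (j + 1) 0 ≠ ω j 0 → ω (j + 1) 1 = ω j 1) := by
    intro j hj
    obtain ⟨c, hc | hc⟩ := (zdGraph_adj_iff _ _).1 (hadj j hj)
    · have hc0' := congrFun hc 0
      have hc1 := congrFun hc 1
      simp only [Pi.add_apply] at hc0' hc1
      fin_cases c
      · simp only [Fin.zero_eta, Pi.single_eq_same] at hc0'
        simp only [Fin.zero_eta, ne_eq, one_ne_zero, not_false_eq_true, Pi.single_eq_of_ne] at hc1
        exact ⟨fun h => by omega, fun _ => by omega⟩
      · simp only [Fin.mk_one, ne_eq, zero_ne_one, not_false_eq_true, Pi.single_eq_of_ne] at hc0'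
        simp only [Fin.mk_one, Pi.single_eq_same] at hc1
        exact ⟨fun _ => Or.inl hc1, fun h => absurd (by omega) h⟩
    · have hc0' := congrFun hc 0
      have hc1 := congrFun hc 1
      simp only [Pi.add_apply] at hc0' hc1
      fin_cases c
      · simp only [Fin.zero_eta, Pi.single_eq_same] at hc0'
        simp only [Fin.zero_eta, ne_eq, one_ne_zero, not_false_eq_true, Pi.single_eq_of_ne] at hc1
        exact ⟨fun h => by omega, fun _ => by omega⟩
      · simp only [Fin.mk_one, ne_eq, zero_ne_one, not_false_eq_true, Pi.single_eq_of_ne] at hc0'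
        simp only [Fin.mk_one, Pi.single_eq_same] at hc1
        exact ⟨fun _ => Or.inr (by omega), fun h => absurd (by omega) h⟩
  have hω11 : ω 1 1 = 0 := by
    have h := (hstep 0 (by omega)).2
    rw [zero_add, h01] at h
    exact h (by rw [hc0 1 le_rfl (by omega), h00]; norm_num)
  have hpm : ∀ j, 1 ≤ j → j < i → ω (j + 1) 1 = ω j 1 + 1 ∨ ω (j + 1) 1 = ω j 1 - 1 := fun j h1 h2 =>
    (hstep j h2).1 (by rw [hc0 j h1 h2.le, hc0 (j + 1) (by omega) h2])
  -- (c) no reversal: `ω(j+2) ≠ ω(j)`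
  have hnorev : ∀ j, 1 ≤ j → j + 1 < i → ω (j + 2) 1 - ω (j + 1) 1 = ω (j + 1) 1 - ω j 1 := by
    intro j h1 h2
    have hne : ω (j + 2) ≠ ω j := fun h => by
      have := hinj (show j + 2 ∈ {k | k ≤ i} by simp only [Set.mem_setOf_eq]; omega)
        (show j ∈ {k | k ≤ i} by simp only [Set.mem_setOf_eq]; omega) h
      omega
    have hne1 : ω (j + 2) 1 ≠ ω j 1 := fun h => hne (Contour.site_ext
      (by rw [hc0 (j + 2) (by omega) (by omega), hc0 j h1 (by omega)]) h)
    rcases hpm j h1 (by omega) with h | h <;> rcases hpm (j + 1) (by omega) h2 with h' | h'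
    · rw [h', h]; ring
    · exfalso; apply hne1; rw [show j + 2 = j + 1 + 1 by ring, h', h]; ring
    · exfalso; apply hne1; rw [show j + 2 = j + 1 + 1 by ring, h', h]; ring
    · rw [h', h]; ring
  -- (d) constant increment `δ = ω 2 1`
  have hincr : ∀ j, 1 ≤ j → j < i → ω (j + 1) 1 - ω j 1 = ω 2 1 := by
    intro j h1 h2
    induction j with
    | zero => omega
    | succ j ih =>
      rcases Nat.eq_zero_or_pos j with rfl | hj
      · rw [zero_add, hω11, sub_zero]
      · rw [show j + 1 + 1 = j + 2 by ring, hnorev j hj h2]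
        exact ih hj (by omega)
  have hval : ∀ j, 1 ≤ j → j ≤ i → ω j 1 = ω 2 1 * ((j : ℤ) - 1) := by
    intro j h1 h2
    induction j with
    | zero => omega
    | succ j ih =>
      rcases Nat.eq_zero_or_pos j with rfl | hj
      · rw [zero_add, hω11]; simp
      · have h := hincr j hj (by omega)
        rw [ih hj (by omega)] at h
        push_cast
        linear_combination h
  have hδ : ω 2 1 = 1 ∨ ω 2 1 = -1 := by
    rcases hpm 1 le_rfl (by omega) with h | h
    · left; rw [h, hω11]; ring
    · right; rw [h, hω11]; ring
  refine ⟨hδ, funext fun j => ?_⟩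
  have key : ∀ j, 1 ≤ j → j ≤ i → ω j = ellWalk (ω 2 1) i j := fun j h1 h2 =>
    Contour.site_ext (by rw [hc0 j h1 h2, ellWalk_apply_fst _ _ h1])
      (by rw [hval j h1 h2, ellWalk_apply_snd _ _ h1, min_eq_left h2])
  rcases Nat.eq_zero_or_pos j with rfl | hj
  · rw [h0, ellWalk_zero]
  · rcases le_or_gt j i with hji | hji
    · exact key j hj hji
    · rw [hend j hji.le, key i (by omega) le_rfl]
      exact Contour.site_ext (by rw [ellWalk_apply_fst _ _ (by omega), ellWalk_apply_fst _ _ hj])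
        (by rw [ellWalk_apply_snd _ _ (by omega), ellWalk_apply_snd _ _ hj, min_self, min_eq_right hji.le])

open Classical in
/-- **The span-one irreducible `i`-step bridges on `ℤ²` (`i ≥ 2`) are exactly the two L-walks.**
[cite: MadrasSlade1993, §4.2, remark after Theorem 4.2.4 (p. 94, 2013 reprint)] -/
theorem irreducibleBridges_filter_span_lt_two {i : ℕ} (hi : 2 ≤ i) :
    (irreducibleBridges 2 i).filter (fun ω => ¬ (2 : ℤ) ≤ ω i 0) = {ellWalk 1 i, ellWalk (-1) i} := by
  classical
  ext ω
  simp only [Finset.mem_filter, Finset.mem_insert, Finset.mem_singleton, not_le]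
  constructor
  · rintro ⟨hω, hlt⟩
    have hb := irreducibleBridges_subset_bridges i hω
    have h1 : 1 ≤ ω i 0 := by
      have := ((mem_bridges.1 hb).2 i (by omega) le_rfl).1
      rw [(mem_saws.1 (mem_bridges.1 hb).1).1] at this
      exact this
    obtain ⟨hδ, heq⟩ := eq_ellWalk_of_span_one hi hb (by omega)
    rcases hδ with h | h
    · left; rw [heq, h]
    · right; rw [heq, h]
  · rintro (rfl | rfl)
    · exact ⟨ellWalk_mem_irreducibleBridges (Or.inl rfl) (by omega), by rw [ellWalk_span 1 (by omega)]; norm_num⟩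
    · exact ⟨ellWalk_mem_irreducibleBridges (Or.inr rfl) (by omega),
        by rw [ellWalk_span (-1) (by omega)]; norm_num⟩

/-- **R35.s1 (part 2): the span-one part of `Λ_i(y)` on `ℤ²` is `2y` for `i ≥ 2`**:
`Λ_i(y) - Λ_i^{(≥2)}(y) = 2y` (the two L-walks, each of span `1`).
[cite: Beaton2015, §3, Lemma 1; MadrasSlade1993, §4.2, remark after Theorem 4.2.4 (p. 94, 2013 reprint)] -/
theorem pulledIrrZ_sub_pulledIrrZ₂ (i : ℕ) (hi : 2 ≤ i) (y : ℝ) :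
    pulledIrrZ 2 i y - pulledIrrZ₂ 2 i y = 2 * y := by
  classical
  rw [pulledIrrZ, pulledIrrZ₂, ← Finset.sum_filter_add_sum_filter_not (irreducibleBridges 2 i)
    (fun ω => (2 : ℤ) ≤ ω i 0), add_sub_cancel_left, irreducibleBridges_filter_span_lt_two hi,
    Finset.sum_pair (ellWalk_one_ne_neg_one hi), ellWalk_span 1 (by omega), ellWalk_span (-1) (by omega)]
  norm_num
  ring

end Literature.Probability.RandomPlanarGeometry.SAW.Zd

end
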